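import Summits.Ventures.PercRepro.C026GluingTransport
import Summits.Ventures.PercRepro.C026ProdCFGluing

/-!
# THEOREM PROD-CF for `k` parts: (CF) on every colour class gives (CF) on the graph (p5, gen 16)

mine-3's Corollary 3 (`proofs/MINE3-PRODUCT.md` §2b: «C-026 at `p = ½` is component-wise») in its
general form. An `ι`-COLOURING `col : E → ι` of the edges of a marked multigraph `G` is a
**multi-gluing** at the marks `a, b, c` (`IsGluingMulti`) when every vertex other than the marks
carries edges of ONE colour — the components of `G − {a, b, c}` (each with its attachment edges)
give one, with the mark–mark edges and loops as further colours. The colour class `i` is the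
part `G.colClassGraph col i` (same vertices, the edges of colour `i`).

* `IsRelabel`, `conn_relabel_iff`, `connAvoid_relabel_iff`, `card_filter_relabel`,
  **`slackCF_relabel`** — relabelling the edges along an equivalence (same vertices, same
  endpoints) changes no count: `Δ_CF` is invariant;
* `slackCF_nonneg_of_isEmpty` — the edgeless graph satisfies (CF);
* **`slackCF_nonneg_of_colouring`** — if every colour class of a multi-gluing satisfies
  `0 ≤ Δ_CF`, so does `G`: induction on the set of colours, peeling one colour off with the
  two-part theorem `slackCF_gluing_nonneg` (the rest is a multi-gluing with one colour fewer, its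
  classes relabelled by `slackCF_relabel`).
-/

namespace PercRepro

open Finset

namespace MultiGraph

/-! ### Relabelling the edges -/

section Relabel

variable {V E₁ E₂ : Type*}

/-- `G₂` is `G₁` with its edges relabelled along `ε`: the same vertices, the same endpoints. -/
def IsRelabel (G₁ : MultiGraph V E₁) (G₂ : MultiGraph V E₂) (ε : E₁ ≃ E₂) : Prop :=
  ∀ e, G₂.fst (ε e) = G₁.fst e ∧ G₂.snd (ε e) = G₁.snd e

variable {G₁ : MultiGraph V E₁} {G₂ : MultiGraph V E₂} {ε : E₁ ≃ E₂}

/-- An open step of the relabelled graph pulls back, and conversely. -/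
theorem openAdj_relabel_iff (h : IsRelabel G₁ G₂ ε) (ω : Config E₂) (x y : V) :
    G₁.OpenAdj (pullConfig ε ω) x y ↔ G₂.OpenAdj ω x y := by
  constructor
  · rintro ⟨e, he, hend⟩
    refine ⟨ε e, he, ?_⟩
    rw [(h e).1, (h e).2]
    exact hend
  · rintro ⟨e, he, hend⟩
    refine ⟨ε.symm e, ?_, ?_⟩
    · simpa [pullConfig] using he
    · rw [← (h (ε.symm e)).1, ← (h (ε.symm e)).2, Equiv.apply_symm_apply]
      exact hend

/-- Connectivity is invariant under relabelling. -/
theorem conn_relabel_iff (h : IsRelabel G₁ G₂ ε) (ω : Config E₂) (x y : V) :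
    G₁.Conn (pullConfig ε ω) x y ↔ G₂.Conn ω x y := by
  unfold Conn
  constructor
  · intro hw
    induction hw with
    | refl => exact Relation.ReflTransGen.refl
    | tail _ hxy ih => exact ih.tail ((openAdj_relabel_iff h ω _ _).mp hxy)
  · intro hw
    induction hw with
    | refl => exact Relation.ReflTransGen.refl
    | tail _ hxy ih => exact ih.tail ((openAdj_relabel_iff h ω _ _).mpr hxy)

/-- The pull-back of the complement is the complement of the pull-back. -/
theorem pullConfig_compl (ε : E₁ ≃ E₂) (ω : Config E₂) :
    pullConfig ε ωᶜ = (pullConfig ε ω)ᶜ := by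
  funext e
  rw [pullConfig_apply, compl_apply_not, compl_apply_not, pullConfig_apply]

/-- Closed connectivity is invariant under relabelling. -/
theorem conn_compl_relabel_iff (h : IsRelabel G₁ G₂ ε) (ω : Config E₂) (x y : V) :
    G₁.Conn (pullConfig ε ω)ᶜ x y ↔ G₂.Conn ωᶜ x y := by
  rw [← pullConfig_compl, conn_relabel_iff h]

/-- Avoiding walks are invariant under relabelling. -/
theorem connAvoid_relabel_iff (h : IsRelabel G₁ G₂ ε) (ω : Config E₂) (X : Set V) (x y : V) :
    G₁.ConnAvoid (pullConfig ε ω) X x y ↔ G₂.ConnAvoid ω X x y := by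
  unfold ConnAvoid
  constructor
  · intro hw
    induction hw with
    | refl => exact Relation.ReflTransGen.refl
    | tail _ hxy ih =>
      exact ih.tail ⟨(openAdj_relabel_iff h ω _ _).mp hxy.1, hxy.2.1, hxy.2.2⟩
  · intro hw
    induction hw with
    | refl => exact Relation.ReflTransGen.refl
    | tail _ hxy ih =>
      exact ih.tail ⟨(openAdj_relabel_iff h ω _ _).mpr hxy.1, hxy.2.1, hxy.2.2⟩

/-- The closed cluster of `c` is invariant under relabelling. -/
theorem cluster_compl_relabel (h : IsRelabel G₁ G₂ ε) (ω : Config E₂) (c : V) :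
    G₁.cluster (pullConfig ε ω)ᶜ c = G₂.cluster ωᶜ c := by
  ext v
  rw [mem_cluster, mem_cluster, conn_compl_relabel_iff h]

open Classical in
/-- A count over the cube of `E₁` is the count of the pulled-back event over the cube of `E₂`. -/
theorem card_filter_relabel [Fintype E₁] [Fintype E₂] (ε : E₁ ≃ E₂) (P : Config E₁ → Prop)
    [DecidablePred P] [DecidablePred fun ω : Config E₂ => P (pullConfig ε ω)] :
    (univ.filter P).card = (univ.filter fun ω : Config E₂ => P (pullConfig ε ω)).card := by
  refine Finset.card_nbij' (fun ω => (pullEquiv ε).symm ω) (fun ω => pullEquiv ε ω) ?_ ?_ ?_ ?_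
  · intro ω hω
    simp only [Finset.coe_filter, Finset.mem_univ, true_and, Set.mem_setOf_eq] at hω ⊢
    rw [← pullEquiv_apply, Equiv.apply_symm_apply]
    exact hω
  · intro ω hω
    simp only [Finset.coe_filter, Finset.mem_univ, true_and, Set.mem_setOf_eq] at hω ⊢
    exact hω
  · intro ω _
    exact (pullEquiv ε).apply_symm_apply ω
  · intro ω _
    exact (pullEquiv ε).symm_apply_apply ω

open Classical in
/-- **`Δ_CF` is invariant under relabelling the edges.** -/
theorem slackCF_relabel [Fintype E₁] [Fintype E₂] (h : IsRelabel G₁ G₂ ε) (a b c : V) :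
    G₁.slackCF a b c = G₂.slackCF a b c := by
  unfold slackCF
  rw [card_filter_relabel ε, card_filter_relabel ε (fun ω => G₁.Conn ω c a ∧ ¬ G₁.Conn ω c b),
    card_filter_relabel ε (fun ω => G₁.Conn ω c b ∧ ¬ G₁.Conn ω c a),
    card_filter_relabel ε (fun ω => G₁.Conn ω a b ∧ ¬ G₁.Conn ωᶜ c a ∧ ¬ G₁.Conn ωᶜ c b)]
  simp only [conn_relabel_iff h, conn_compl_relabel_iff h]

end Relabel

/-! ### Multi-gluings -/

section Multi

variable {V : Type*}

/-- **A multi-gluing**: an `ι`-colouring of the edges in which every vertex other than the marks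
`a, b, c` carries edges of one colour only (the components of `G − {a, b, c}` give one). -/
def IsGluingMulti {E ι : Type*} (G : MultiGraph V E) (a b c : V) (col : E → ι) : Prop :=
  ∀ v, v ≠ a → v ≠ b → v ≠ c → ∀ e e', G.EdgeAt e v → G.EdgeAt e' v → col e = col e'

/-- The colour class `i` as a marked multigraph on the same vertices. -/
def colClassGraph {E ι : Type*} (G : MultiGraph V E) (col : E → ι) (i : ι) :
    MultiGraph V {e // col e = i} :=
  ⟨fun e => G.fst e.1, fun e => G.snd e.1⟩

open Classical in
/-- The edgeless graph satisfies (CF): `N_AB ⊆ ab|c` there. -/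
theorem slackCF_nonneg_of_isEmpty {E : Type*} [Fintype E] [IsEmpty E] (G : MultiGraph V E)
    (a b c : V) : 0 ≤ G.slackCF a b c := by
  unfold slackCF
  have hle : (univ.filter fun ω : Config E =>
      G.Conn ω a b ∧ ¬ G.Conn ωᶜ c a ∧ ¬ G.Conn ωᶜ c b).card ≤
      (univ.filter fun ω : Config E => G.Conn ω a b ∧ ¬ G.Conn ω a c).card := by
    refine Finset.card_le_card fun ω hω => ?_
    simp only [Finset.mem_filter, Finset.mem_univ, true_and] at hω ⊢
    refine ⟨hω.1, fun hac => hω.2.1 ?_⟩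
    have : c = a := eq_of_conn_of_forall_eq_false (fun e => isEmptyElim e) hac
    rw [this]
    exact Conn.refl _ _ _
  have h1 := Nat.cast_nonneg (α := ℤ)
    (univ.filter fun ω : Config E => G.Conn ω c a ∧ ¬ G.Conn ω c b).card
  have h2 := Nat.cast_nonneg (α := ℤ)
    (univ.filter fun ω : Config E => G.Conn ω c b ∧ ¬ G.Conn ω c a).card
  zify at hle
  linarith

/-- A multi-gluing restricted to the edges of a part is a multi-gluing. -/
theorem IsGluingMulti.part {E ι : Type*} {G : MultiGraph V E} {a b c : V} {col : E → ι}
    (hg : G.IsGluingMulti a b c col) (side : E → Bool) (s : Bool) :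
    (G.part side s).IsGluingMulti a b c fun e => col e.1 := by
  intro v hva hvb hvc e e' he he'
  exact hg v hva hvb hvc e.1 e'.1 he he'

open Classical in
/-- **THEOREM PROD-CF for `k` parts** (mine-3's Corollary 3 in general form): for a multi-gluing
whose colours lie in the finite set `S`, `0 ≤ Δ_CF` on every colour class in `S` gives
`0 ≤ Δ_CF` on `G`. Induction on `S`: one colour is peeled off by the two-part theorem
`slackCF_gluing_nonneg`. -/
theorem slackCF_nonneg_of_colouring_aux {ι : Type*} [DecidableEq ι] (a b c : V) (S : Finset ι) :
    ∀ {E : Type*} [Fintype E] (G : MultiGraph V E) (col : E → ι),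
      G.IsGluingMulti a b c col → (∀ e, col e ∈ S) →
      (∀ i ∈ S, 0 ≤ (G.colClassGraph col i).slackCF a b c) → 0 ≤ G.slackCF a b c := by
  induction S using Finset.induction_on with
  | empty =>
    intro E _ G col _ hS _
    haveI : IsEmpty E := ⟨fun e => by simpa using hS e⟩
    exact slackCF_nonneg_of_isEmpty G a b c
  | insert i S hi ih =>
    intro E _ G col hg hS h
    -- the two-colouring: colour `i` on side `true`, the other colours on side `false`
    let side : E → Bool := fun e => decide (col e = i)
    have hglue : G.IsGluing a b c side := by
      intro v hva hvb hvc e e' he he'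
      simp only [side, hg v hva hvb hvc e e' he he']
    refine slackCF_gluing_nonneg hglue ?_ ?_
    · -- the side `true` is the colour class `i`, relabelled
      have hrel : IsRelabel (G.part side true) (G.colClassGraph col i)
          (Equiv.subtypeEquivRight fun e => by simp [side]) := fun e => ⟨rfl, rfl⟩
      rw [slackCF_relabel hrel]
      exact h i (Finset.mem_insert_self i S)
    · -- the side `false` is a multi-gluing with colours in `S`
      refine ih (G.part side false) (fun e => col e.1) (hg.part side false) ?_ ?_
      · intro e
        have he := hS e.1
        have hne : col e.1 ≠ i := by
          have := e.2
          simpa [side] using this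
        exact Finset.mem_of_mem_insert_of_ne he hne
      · intro j hj
        have hji : j ≠ i := fun hji => hi (hji ▸ hj)
        have hrel : IsRelabel ((G.part side false).colClassGraph (fun e => col e.1) j) (G.colClassGraph col j)
            (Equiv.subtypeSubtypeEquivSubtype fun {e} (he : col e = j) => by
              simp [side, he, hji]) := fun e => ⟨rfl, rfl⟩
        rw [slackCF_relabel hrel]
        exact h j (Finset.mem_insert_of_mem hj)

open Classical in
/-- **THEOREM PROD-CF for `k` parts** (mine-3's Corollary 3: C-026 at `p = ½` is component-wise):
for a multi-gluing with finitely many colours, `0 ≤ Δ_CF` on every colour class gives `0 ≤ Δ_CF`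
on `G`. -/
theorem slackCF_nonneg_of_colouring {E ι : Type*} [Fintype E] [Fintype ι] [DecidableEq ι]
    (G : MultiGraph V E) {a b c : V} {col : E → ι} (hg : G.IsGluingMulti a b c col)
    (h : ∀ i, 0 ≤ (G.colClassGraph col i).slackCF a b c) : 0 ≤ G.slackCF a b c :=
  slackCF_nonneg_of_colouring_aux a b c Finset.univ G col hg (fun _ => Finset.mem_univ _)
    fun i _ => h i

end Multi

end MultiGraph

end PercRepro
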